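import Summits.QuantumFields.YangMills.Theses.ConvexGribovBody
import Summits.QuantumFields.YangMills.Theorems.ConvexGribovBodyContinuumLegGivenGapStubAlongSequence
import Summits.QuantumFields.YangMills.Theorems.ConvexGribovBodyContinuumLegGivenGapThreshold
import Summits.QuantumFields.YangMills.Theorems.OSLegsFromFemtoAndGap.Negative.UnitsAndGapFree

/-!
# `ContinuumLegGivenGap` (stmt-QuantumFields-15828) — negative-side support for the RE-TYPED crux:
# what `HasWeakCouplingLimit` changes, and the reshape-7 IR stub `stub_lock` is not soft

Support file for crux `stmt-QuantumFields-15828` (`Summit.QuantumFields.YangMills.Theses.ConvexGribovBody.ContinuumLegGivenGap`,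
re-typed 2026-08-16: conclusion `sch.HasWeakCouplingLimit ∧ …`; twins in SmallCircleAnchor / HyperbolicRegulator /
ContractibleFibre), extracted from the standing disprover's work file `Cruxes/ContinuumLegGivenGap/Disproof.lean`
(gen 2, §2–§3).  Tree objects only, nothing posited, no `def`: the crux's hypothesis at `(G, r)` ("GapHypAt") and the
conclusion-minus-non-triviality ("ConclMinus": `∃ sch T, sch.HasWeakCouplingLimit ∧ IsYangMillsFor r sch T ∧ ∃ Δ > 0,
T.HasMassGap Δ ∧ HasLatticeMassGap r sch Δ`) are written out verbatim.

* `hasWeakCouplingLimit_vacuum_witness` (with the landed `isYangMillsFor_vacuum_of_c_zero`): the new clause ALONE is not load-bearing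
  against the vacuum witness — for every `G, r` there is a scheme with `β_k = k → ∞`, `c ≡ 0`, tied to the vacuum OS
  datum, with every continuum mass gap, neither non-trivial nor non-Gaussian.
* `conclMinus_iff_seqLatticeGap`: ConclMinus at `(G, r)` is EXACTLY a sequential weak-coupling volume-uniform lattice
  gap in physical units (`a_k → 0⁺`, `β_k → ∞`, `a_k L_k → ∞`, one constant per pair, rate `Δ a_k`).
* `seqLatticeGap_of_gapHyp`, `conclMinus_of_gapHyp`: the re-type makes the crux's hypothesis CONSUMABLE — per-β torus
  clustering above `β₀` ⇒ (landed `stub_alongSequence`: k-uniform constants at sacrificed rates `m_k` along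
  `β_k := max β₀ 0 + k`) ⇒ the sequential lattice gap with FREE spacings `a_k := min (1/(k+1)) (m_k)`.  So the crux
  minus its two interacting clauses is a theorem whose proof uses the hypothesis (gen 1's hypothesis-free zero-scheme
  witness is dead: `β ≡ 0` is not a weak-coupling limit); all difficulty sits in `IsNontrivial ∧ IsNonGaussian` at
  `β_k → ∞`, where the spacings can no longer be chosen freely.
* `abstract_lock_false`: the reshape-7 stub `stub_lock` (k-UNIFORM pair constants along SOME `β_k → ∞` at a rate sharp
  within a factor) is NOT a soft consequence of GapHyp-shaped data: a family bounded by `2`, continuous in `β`,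
  clustering at EVERY coupling at the common sharp rate `1`, admits k-uniform constants along NO sequence `β_k → ∞` at
  ANY rates bounded below (plateau of length `jβ⁺`: a log-concavity that reflection positivity forbids).
* `osNorm_constants`: with transfer-matrix structure (`‖T‖ ≤ e^{−m}` off the vacuum) the constants are free at the
  exact rate, `|⟪ψ, Tⁿφ⟫| ≤ e^{−mn}‖ψ‖‖φ‖` — so `stub_lock` is not refutable by RP-compatible abstract data either; its
  content is the finite-torus thermal window at `n ≤ S`. [folklore]
-/

noncomputable section

open scoped SchwartzMap
open Filter Topology MeasureTheory
open Literature.MathematicalPhysics.AQFT Literature.MathematicalPhysics.QuantumLattice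
open Literature.MathematicalPhysics.QuantumFieldTheory
open Summit.QuantumFields.YangMills.Theorems.OSLegsFromFemtoAndGap.Negative (isYangMillsFor_vacuum_of_c_zero)

namespace Summit.QuantumFields.YangMills.Theorems.ContinuumLegGivenGap.Negative

/-! ## The new clause against the vacuum witness -/

section Vacuum

variable {G : Type} [Group G] [MeasurableSpace G] [TopologicalSpace G] [IsTopologicalGroup G] [CompactSpace G]
  [BorelSpace G]

/-- **`HasWeakCouplingLimit` alone is not load-bearing against the vacuum witness**: for every `G, r` the scheme
`a_k = 1/(k+1)`, `β_k = k`, `L_k = (k+1)²`, `c ≡ m ≡ 0` with the vacuum OS datum has the weak-coupling clause,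
`IsYangMillsFor`, EVERY continuum mass gap, and is neither non-trivial nor non-Gaussian in `tr F²`.  (What the new
clause does change is the lattice clause: `HasLatticeMassGap` at `β_k → ∞` is no longer free — below.) [folklore] -/
theorem hasWeakCouplingLimit_vacuum_witness (r : LatticeRep G) :
    ∃ sch : SpeciesScheme (YMSpecies G), sch.HasWeakCouplingLimit ∧
      IsYangMillsFor r sch (OSData.vacuum (YMSpecies G) 4) ∧
      (∀ Δ : ℝ, (OSData.vacuum (YMSpecies G) 4).HasMassGap Δ) ∧
      ¬ (OSData.vacuum (YMSpecies G) 4).IsNontrivial r.curvature ∧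
      ¬ (OSData.vacuum (YMSpecies G) 4).IsNonGaussian r.curvature := by
  have hL : Tendsto (fun k : ℕ => ((k : ℝ) + 1)⁻¹ * (((k + 1) ^ 2 : ℕ) : ℝ)) atTop atTop := by
    have h : (fun k : ℕ => ((k : ℝ) + 1)⁻¹ * (((k + 1) ^ 2 : ℕ) : ℝ)) = fun k : ℕ => (k : ℝ) + 1 := by
      funext k; push_cast; field_simp
    rw [h]
    exact tendsto_natCast_atTop_atTop.atTop_add tendsto_const_nhds
  refine ⟨{ a := fun k => ((k : ℝ) + 1)⁻¹, a_pos := fun k => by positivity,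
            tendsto_a := tendsto_inv_atTop_zero.comp (tendsto_natCast_atTop_atTop.atTop_add tendsto_const_nhds),
            β := fun k => k, L := fun k => (k + 1) ^ 2, tendsto_L := hL,
            c := fun _ _ => 0, m := fun _ _ => 0 }, tendsto_natCast_atTop_atTop,
    isYangMillsFor_vacuum_of_c_zero r _ fun _ _ => rfl, OSData.vacuum_hasMassGap,
    OSData.not_isNontrivial_vacuum _, OSData.not_isNonGaussian_vacuum _⟩

/-- **ConclMinus ↔ sequential lattice gap.**  At `(G, r)`, the crux's conclusion with `IsNontrivial ∧ IsNonGaussian`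
deleted holds iff there are spacings `a_k → 0⁺`, couplings `β_k → +∞`, half-sides with `a_k L_k → ∞` and ONE constant
per pair of local observables with `|corr_{β_k,2S+1}(A,B;n)| ≤ C e^{−Δ a_k n}` for all large `k`, all `S ≥ L_k`,
`n ≤ S`, some `Δ > 0` (`→`: forget the OS datum and the renormalisations; `←`: `c ≡ m ≡ 0` and the vacuum datum).
[folklore] -/
theorem conclMinus_iff_seqLatticeGap (r : LatticeRep G) :
    (∃ (sch : SpeciesScheme (YMSpecies G)) (T : OSData (YMSpecies G) 4),
      sch.HasWeakCouplingLimit ∧ IsYangMillsFor r sch T ∧ ∃ Δ > 0, T.HasMassGap Δ ∧ HasLatticeMassGap r sch Δ) ↔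
    ∃ (a : ℕ → ℝ) (β : ℕ → ℝ) (L : ℕ → ℕ), (∀ k, 0 < a k) ∧ Tendsto a atTop (𝓝 0) ∧
      Tendsto (fun k => a k * L k) atTop atTop ∧ Tendsto β atTop atTop ∧
      ∃ Δ > 0, ∀ A B : YMSpecies G, ∃ C : ℝ, ∀ᶠ k in atTop, ∀ S : ℕ, L k ≤ S → ∀ n : ℕ, n ≤ S →
        |latticeConnectedCorr r.ρ (β k) (2 * S + 1) A.F B.F n| ≤ C * Real.exp (-(Δ * (a k * n))) := by
  constructor
  · rintro ⟨sch, T, hw, -, Δ, hΔ, -, hL⟩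
    exact ⟨sch.a, sch.β, sch.L, sch.a_pos, sch.tendsto_a, sch.tendsto_L, hw, Δ, hΔ, hL⟩
  · rintro ⟨a, β, L, ha, ha0, haL, hβ, Δ, hΔ, hL⟩
    let sch : SpeciesScheme (YMSpecies G) :=
      { a := a, a_pos := ha, tendsto_a := ha0, β := β, L := L, tendsto_L := haL,
        c := fun _ _ => 0, m := fun _ _ => 0 }
    exact ⟨sch, OSData.vacuum _ 4, hβ, isYangMillsFor_vacuum_of_c_zero r sch fun _ _ => rfl, Δ, hΔ,
      OSData.vacuum_hasMassGap Δ, hL⟩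

/-- **THE RE-TYPE MAKES THE HYPOTHESIS CONSUMABLE: GapHypAt `(G, r)` ⇒ the sequential lattice gap.**  Torus clustering
above `β₀` (threshold absorbed, landed `gapHyp_iff_torusClusteringAt`) ⇒ along `β_k := max β₀ 0 + k → ∞` the landed
`stub_alongSequence` gives k-UNIFORM per-pair constants at (sacrificed) rates `m_k > 0`; with `a_k := min (1/(k+1)) (m_k)`
(`1 · a_k ≤ m_k`) and `L_k := ⌈(k+1)/a_k⌉₊` (`a_k L_k ≥ k+1`) the bound reads `C e^{−1·a_k n}`.  The rate sacrifice is
absorbed by the FREE spacings — i.e. by giving up any relation between `a_k` and the physical correlation length,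
exactly the freedom the interacting clauses remove. [folklore] -/
theorem seqLatticeGap_of_gapHyp (r : LatticeRep G)
    (h : ∃ β₀ : ℝ, ∀ β : ℝ, β₀ ≤ β → ∃ m : ℝ, 0 < m ∧ ∃ S₁ : ℕ, ∀ A B : YMSpecies G, ∃ C : ℝ,
      ∀ S n : ℕ, S₁ ≤ S → n ≤ S →
        |latticeConnectedCorr r.ρ β (2 * S + 1) A.F B.F n| ≤ C * Real.exp (-(m * n))) :
    ∃ (a : ℕ → ℝ) (β : ℕ → ℝ) (L : ℕ → ℕ), (∀ k, 0 < a k) ∧ Tendsto a atTop (𝓝 0) ∧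
      Tendsto (fun k => a k * L k) atTop atTop ∧ Tendsto β atTop atTop ∧
      ∃ Δ > 0, ∀ A B : YMSpecies G, ∃ C : ℝ, ∀ᶠ k in atTop, ∀ S : ℕ, L k ≤ S → ∀ n : ℕ, n ≤ S →
        |latticeConnectedCorr r.ρ (β k) (2 * S + 1) A.F B.F n| ≤ C * Real.exp (-(Δ * (a k * n))) := by
  obtain ⟨β₀, hβ₀⟩ := (gapHyp_iff_torusClusteringAt r).1 h
  obtain ⟨m, hm, hC⟩ := stub_alongSequence G r (fun k : ℕ => max β₀ 0 + k)
    fun k => hβ₀ _ ((le_max_left β₀ 0).trans (le_add_of_nonneg_right (Nat.cast_nonneg k)))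
  set a : ℕ → ℝ := fun k => min (((k : ℝ) + 1)⁻¹) (m k) with ha_def
  have ha_pos : ∀ k, 0 < a k := fun k => lt_min (by positivity) (hm k)
  have ha_le_inv : ∀ k, a k ≤ ((k : ℝ) + 1)⁻¹ := fun k => min_le_left _ _
  have ha_le_m : ∀ k, a k ≤ m k := fun k => min_le_right _ _
  have ha0 : Tendsto a atTop (𝓝 0) := by
    have hinv : Tendsto (fun k : ℕ => ((k : ℝ) + 1)⁻¹) atTop (𝓝 0) :=
      tendsto_inv_atTop_zero.comp (tendsto_natCast_atTop_atTop.atTop_add tendsto_const_nhds)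
    exact tendsto_of_tendsto_of_tendsto_of_le_of_le tendsto_const_nhds hinv (fun k => (ha_pos k).le) ha_le_inv
  set L : ℕ → ℕ := fun k => ⌈((k : ℝ) + 1) / a k⌉₊ with hL_def
  have hk1 : Tendsto (fun k : ℕ => (k : ℝ) + 1) atTop atTop :=
    tendsto_natCast_atTop_atTop.atTop_add tendsto_const_nhds
  have haL : Tendsto (fun k => a k * L k) atTop atTop := by
    refine tendsto_atTop_mono (fun k => ?_) hk1
    have hk : ((k : ℝ) + 1) = a k * (((k : ℝ) + 1) / a k) := by field_simp [(ha_pos k).ne']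
    calc (k : ℝ) + 1 = a k * (((k : ℝ) + 1) / a k) := hk
      _ ≤ a k * (L k : ℝ) := mul_le_mul_of_nonneg_left (Nat.le_ceil _) (ha_pos k).le
  refine ⟨a, fun k => max β₀ 0 + k, L, ha_pos, ha0, haL,
    tendsto_atTop_add_const_left atTop (max β₀ 0) tendsto_natCast_atTop_atTop, 1, one_pos, fun A B => ?_⟩
  obtain ⟨C, hCAB⟩ := hC A B
  refine ⟨max C 0, Eventually.of_forall fun k S _ n hn => (hCAB k S n hn).trans ?_⟩
  have hexp : Real.exp (-(m k * n)) ≤ Real.exp (-(1 * (a k * n))) := by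
    refine Real.exp_le_exp.2 (neg_le_neg ?_)
    rw [one_mul]
    exact mul_le_mul_of_nonneg_right (ha_le_m k) (Nat.cast_nonneg n)
  calc C * Real.exp (-(m k * n)) ≤ max C 0 * Real.exp (-(m k * n)) :=
        mul_le_mul_of_nonneg_right (le_max_left _ _) (Real.exp_pos _).le
    _ ≤ max C 0 * Real.exp (-(1 * (a k * n))) := mul_le_mul_of_nonneg_left hexp (le_max_right _ _)

/-- **ConclMinus from GapHypAt** (corollary): the crux with its two interacting clauses deleted is a theorem at every
`(G, r)` where the hypothesis holds — and, unlike before the re-type, the proof USES the hypothesis. [folklore] -/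
theorem conclMinus_of_gapHyp (r : LatticeRep G)
    (h : ∃ β₀ : ℝ, ∀ β : ℝ, β₀ ≤ β → ∃ m : ℝ, 0 < m ∧ ∃ S₁ : ℕ, ∀ A B : YMSpecies G, ∃ C : ℝ,
      ∀ S n : ℕ, S₁ ≤ S → n ≤ S →
        |latticeConnectedCorr r.ρ β (2 * S + 1) A.F B.F n| ≤ C * Real.exp (-(m * n))) :
    ∃ (sch : SpeciesScheme (YMSpecies G)) (T : OSData (YMSpecies G) 4),
      sch.HasWeakCouplingLimit ∧ IsYangMillsFor r sch T ∧ ∃ Δ > 0, T.HasMassGap Δ ∧ HasLatticeMassGap r sch Δ :=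
  (conclMinus_iff_seqLatticeGap r).2 (seqLatticeGap_of_gapHyp r h)

omit [MeasurableSpace G] [BorelSpace G] in
/-- **The crux minus its interacting clauses, for the record**: for every compact simple `G`, GapHyp `G` ⇒ some
faithful `r` carries ConclMinus (the `r` is the one `IsCompactSimpleLieGroup` supplies). [folklore] -/
theorem continuumLegGivenGap_minus_nontriviality :
    ∀ (G : Type) [Group G] [TopologicalSpace G] [IsTopologicalGroup G] [CompactSpace G],
      IsCompactSimpleLieGroup G →
        letI : MeasurableSpace G := borel G
        haveI : BorelSpace G := ⟨rfl⟩
        (∀ r : LatticeRep G, ∃ β₀ : ℝ, ∀ β : ℝ, β₀ ≤ β → ∃ m : ℝ, 0 < m ∧ ∃ S₁ : ℕ,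
          ∀ A B : YMSpecies G, ∃ C : ℝ, ∀ S n : ℕ, S₁ ≤ S → n ≤ S →
            |latticeConnectedCorr r.ρ β (2 * S + 1) A.F B.F n| ≤ C * Real.exp (-(m * n))) →
        ∃ (r : LatticeRep G) (sch : SpeciesScheme (YMSpecies G)) (T : OSData (YMSpecies G) 4),
          sch.HasWeakCouplingLimit ∧ IsYangMillsFor r sch T ∧
            ∃ Δ > 0, T.HasMassGap Δ ∧ HasLatticeMassGap r sch Δ := by
  intro G _ _ _ _ hG
  letI : MeasurableSpace G := borel G
  haveI : BorelSpace G := ⟨rfl⟩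
  intro h
  obtain ⟨r⟩ := hG.2
  exact ⟨r, conclMinus_of_gapHyp r (h r)⟩

end Vacuum

/-! ## Reshape 7, `stub_lock`: not soft, not abstractly refutable -/

section Lock

/-- **`stub_lock` is not soft (abstract non-lockability without positivity).**  There is a family of "pair
correlations" `f j β S n` with `0 ≤ f ≤ 2`, CONTINUOUS in `β`, having the GapHyp shape at EVERY coupling at the common
rate `1` (per-pair per-β constants; the rate `1` is sharp: after its plateau the family IS `2e^{jβ⁺}e^{−n}`), such that
along NO sequence `β_k → +∞` do k-uniform per-pair constants exist at rates bounded below by any `μ > 0` — a fortiori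
not at rates within a factor `4` of the sharp rate.  Witness `f j β S n = 2·min(1, e^{−(n − jβ⁺)})`: pair `j = 1` sits at
value `2` up to time `⌊β_k⁺⌋ → ∞`.  (The kink is log-CONCAVE, which reflection positivity forbids: any proof of the
stub must use RP / spectral structure.) [folklore] -/
theorem abstract_lock_false :
    ∃ f : ℕ → ℝ → ℕ → ℕ → ℝ, (∀ j β S n, 0 ≤ f j β S n ∧ f j β S n ≤ 2) ∧
      (∀ j S n, Continuous fun β => f j β S n) ∧
      (∀ β : ℝ, ∀ j : ℕ, ∃ C : ℝ, ∀ S n : ℕ, n ≤ S → f j β S n ≤ C * Real.exp (-(1 * (n : ℝ)))) ∧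
      ¬ ∃ βs : ℕ → ℝ, Tendsto βs atTop atTop ∧ ∃ (m : ℕ → ℝ) (μ : ℝ), 0 < μ ∧ (∀ k, μ ≤ m k) ∧
          ∀ j : ℕ, ∃ C : ℝ, ∀ k S n : ℕ, n ≤ S → f j (βs k) S n ≤ C * Real.exp (-(m k * n)) := by
  set p : ℕ → ℝ → ℕ → ℝ := fun j β n => 2 * min 1 (Real.exp (-((n : ℝ) - j * max β 0))) with hp
  have hp_two : ∀ {j : ℕ} {β : ℝ} {n : ℕ}, (n : ℝ) ≤ j * max β 0 → p j β n = 2 := fun {j β n} hn => by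
    simp only [hp]
    have h1 : (1 : ℝ) ≤ Real.exp (-((n : ℝ) - j * max β 0)) := by rw [Real.one_le_exp_iff]; linarith
    rw [min_eq_left h1, mul_one]
  refine ⟨fun j β _ n => p j β n, fun j β _ n => ⟨?_, ?_⟩, fun j _ n => ?_, fun β j => ?_, ?_⟩
  · exact mul_nonneg zero_le_two (le_min zero_le_one (Real.exp_pos _).le)
  · have h : min 1 (Real.exp (-((n : ℝ) - j * max β 0))) ≤ 1 := min_le_left _ _
    show 2 * min 1 (Real.exp (-((n : ℝ) - j * max β 0))) ≤ 2
    linarith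
  · show Continuous fun β : ℝ => 2 * min 1 (Real.exp (-((n : ℝ) - j * max β 0)))
    fun_prop
  · refine ⟨2 * Real.exp (j * max β 0), fun S n _ => ?_⟩
    show 2 * min 1 (Real.exp (-((n : ℝ) - j * max β 0))) ≤ 2 * Real.exp (j * max β 0) * Real.exp (-(1 * (n : ℝ)))
    have h : min 1 (Real.exp (-((n : ℝ) - j * max β 0))) ≤
        Real.exp (j * max β 0) * Real.exp (-(1 * (n : ℝ))) := by
      refine (min_le_right _ _).trans (le_of_eq ?_)
      rw [← Real.exp_add]; congr 1; ring
    calc 2 * min 1 (Real.exp (-((n : ℝ) - j * max β 0)))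
        ≤ 2 * (Real.exp (j * max β 0) * Real.exp (-(1 * (n : ℝ)))) := mul_le_mul_of_nonneg_left h zero_le_two
      _ = 2 * Real.exp (j * max β 0) * Real.exp (-(1 * (n : ℝ))) := by ring
  · rintro ⟨βs, hβs, m, μ, hμ, hμm, hC⟩
    obtain ⟨C, hC1⟩ := hC 1
    have hval : ∀ k, (2 : ℝ) ≤ C * Real.exp (-(μ * (⌊max (βs k) 0⌋₊ : ℕ))) := fun k => by
      have hn : ((⌊max (βs k) 0⌋₊ : ℕ) : ℝ) ≤ 1 * max (βs k) 0 := by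
        rw [one_mul]; exact Nat.floor_le (le_max_right _ _)
      have h2 : p 1 (βs k) ⌊max (βs k) 0⌋₊ = 2 := hp_two (by exact_mod_cast hn)
      have hk : p 1 (βs k) ⌊max (βs k) 0⌋₊ ≤ C * Real.exp (-(m k * (⌊max (βs k) 0⌋₊ : ℕ))) :=
        hC1 k ⌊max (βs k) 0⌋₊ ⌊max (βs k) 0⌋₊ le_rfl
      rw [h2] at hk
      refine hk.trans ?_
      have hC0 : 0 ≤ C :=
        nonneg_of_mul_nonneg_left ((show (0 : ℝ) < 2 by norm_num).le.trans hk) (Real.exp_pos _)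
      refine mul_le_mul_of_nonneg_left (Real.exp_le_exp.2 (neg_le_neg ?_)) hC0
      exact mul_le_mul_of_nonneg_right (hμm k) (Nat.cast_nonneg _)
    have hfloor : Tendsto (fun k => ((⌊max (βs k) 0⌋₊ : ℕ) : ℝ)) atTop atTop := by
      have h1 : Tendsto (fun k => max (βs k) 0) atTop atTop := tendsto_atTop_mono (fun k => le_max_left _ _) hβs
      exact tendsto_natCast_atTop_atTop.comp (tendsto_nat_floor_atTop.comp h1)
    have hlim : Tendsto (fun k => C * Real.exp (-(μ * ((⌊max (βs k) 0⌋₊ : ℕ) : ℝ)))) atTop (𝓝 0) := by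
      have h3 : Tendsto (fun k => μ * ((⌊max (βs k) 0⌋₊ : ℕ) : ℝ)) atTop atTop :=
        Tendsto.const_mul_atTop hμ hfloor
      have h4 := Real.tendsto_exp_atBot.comp (tendsto_neg_atTop_atBot.comp h3)
      simpa using h4.const_mul C
    have : (2 : ℝ) ≤ 0 := ge_of_tendsto' hlim hval
    linarith

/-- **With transfer-matrix structure the constants are free at the exact rate** (why no RP-compatible abstract family
refutes `stub_lock` at the level of infinite-volume OS data): for a bounded operator `T` with `‖T‖ ≤ e^{−m}` on a real
inner-product space — the transfer matrix off the vacuum, `m` the spectral gap — and any two vectors (the OS vectors of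
two local observables), `|⟪ψ, Tⁿφ⟫| ≤ e^{−mn}‖ψ‖‖φ‖`: OS-norm constants, uniform in the pair up to its norms, in the
coupling and in `n`, at the sharp rate.  The content of `stub_lock` is therefore the TORUS side at `n ≤ S` (thermal
trace vs matrix element, the multiplicity of low-lying states), not requantisation or sharpness. [folklore] -/
theorem osNorm_constants {E : Type*} [NormedAddCommGroup E] [InnerProductSpace ℝ E] (T : E →L[ℝ] E) {m : ℝ}
    (hT : ‖T‖ ≤ Real.exp (-m)) (ψ φ : E) (n : ℕ) :
    |@inner ℝ E _ ψ ((T ^ n) φ)| ≤ Real.exp (-(m * n)) * (‖ψ‖ * ‖φ‖) := by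
  have hpow : ‖(T ^ n) φ‖ ≤ Real.exp (-(m * n)) * ‖φ‖ := by
    have h1 : ‖(T ^ n) φ‖ ≤ ‖T ^ n‖ * ‖φ‖ := (T ^ n).le_opNorm φ
    have h2 : ‖T ^ n‖ ≤ ‖T‖ ^ n := by
      rcases Nat.eq_zero_or_pos n with rfl | hn
      · simp only [pow_zero]
        exact ContinuousLinearMap.norm_id_le
      · exact norm_pow_le' T hn
    have h3 : ‖T‖ ^ n ≤ Real.exp (-m) ^ n := pow_le_pow_left₀ (norm_nonneg _) hT n
    have h4 : Real.exp (-m) ^ n = Real.exp (-(m * n)) := by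
      rw [← Real.exp_nat_mul]; congr 1; ring
    calc ‖(T ^ n) φ‖ ≤ ‖T ^ n‖ * ‖φ‖ := h1
      _ ≤ Real.exp (-(m * n)) * ‖φ‖ :=
          mul_le_mul_of_nonneg_right (h2.trans (h3.trans h4.le)) (norm_nonneg _)
  calc |@inner ℝ E _ ψ ((T ^ n) φ)| ≤ ‖ψ‖ * ‖(T ^ n) φ‖ := abs_real_inner_le_norm _ _
    _ ≤ ‖ψ‖ * (Real.exp (-(m * n)) * ‖φ‖) := mul_le_mul_of_nonneg_left hpow (norm_nonneg _)
    _ = Real.exp (-(m * n)) * (‖ψ‖ * ‖φ‖) := by ring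

/-- **Symmetric moment sequences are log-convex** (the positivity the plateau violates): for a symmetric bounded
operator, `⟪ψ, Tψ⟫² ≤ ⟪ψ, ψ⟫ ⟪ψ, T²ψ⟫` (Cauchy–Schwarz); iterated along `Tⁿψ` this is log-convexity of
`n ↦ ⟪ψ, Tⁿψ⟫`, incompatible with a plateau followed by a faster tail. [folklore] -/
theorem symmetric_moment_logConvex {E : Type*} [NormedAddCommGroup E] [InnerProductSpace ℝ E] (T : E →L[ℝ] E)
    (hT : ∀ x y : E, @inner ℝ E _ (T x) y = @inner ℝ E _ x (T y)) (ψ : E) :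
    (@inner ℝ E _ ψ (T ψ)) ^ 2 ≤ @inner ℝ E _ ψ ψ * @inner ℝ E _ ψ (T (T ψ)) := by
  have hcs := real_inner_mul_inner_self_le ψ (T ψ)
  rw [← hT ψ (T ψ)] at *
  calc (@inner ℝ E _ ψ (T ψ)) ^ 2 = @inner ℝ E _ ψ (T ψ) * @inner ℝ E _ ψ (T ψ) := sq _
    _ ≤ @inner ℝ E _ ψ ψ * @inner ℝ E _ (T ψ) (T ψ) := hcs

end Lock

end Summit.QuantumFields.YangMills.Theorems.ContinuumLegGivenGap.Negative

end
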